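import Literature.Probability.MarkovChains.BirthDeathHittingTimes

/-!
HONEST FRAMING: exact (Metropolis-corrected) sampling algorithms for lattice gauge theory; figures
of merit are autocorrelation/cost numbers at stated couplings and volumes; no continuum-physics
claim.

# SwapLadderDeliveryTime — IN THE IDEALISED LABEL WALK OF A `K`-INTERVAL REPLICA LADDER WITH UNIFORM
# SWAP ACCEPTANCE `a`, A CONFIGURATION BORN AT ONE END REACHES THE OTHER END AFTER EXACTLY `K(K+1)/a`
# SWAP ROUNDS IN EXPECTATION — the diffusive `K²/a` of `Scaling/SwapSpacingOptimum`'s model step (M2),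
# with its finite-`K` factor `1 + 1/K ∈ (1, 2]` (row 22 `su3-ptbc`, GEN-4, ours)

Venture `LatticeQCDFlow` (cell pub-lqcd), topic `Scaling`; FANOUT row 22 (`su3-ptbc`, PTBC comparator arm
E4).  NEW WORK of the cell = an INSTANCE of the tree's Literature birth-and-death hitting times
(`Literature.Probability.MarkovChains.BirthDeathHittingTimes`: Levin–Peres–Wilmer §2.5,
`LevinPeres2017_sec_2_5_const_eq` (`E_{ℓ−1}(τ_ℓ) = ℓ/p` for `p = q`) and `LevinPeres2017_sec_2_5_sum`
("to find `E_a(τ_b)`, just sum"); conventions `bdKernel`, `IsHittingTimeSolution`).  Nothing is cited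
as a fact.

## The idealised label walk (the standard "diffusion in replica space" picture; e.g. Katzgraber–Trebst–
## Huse–Troyer, J. Stat. Mech. (2006) P03018, NAMED ONLY)

Positions `0, 1, …, K` on the ladder (PTBC: `0` = the open replica `c = 0`, where topological sectors
change freely; `K` = the periodic, physical replica `c = 1`); one swap ROUND proposes, for the tracked
configuration, a move to one uniformly chosen neighbour side, accepted with the (tuned, uniform)
stationary acceptance `a`: up with probability `a/2`, down with probability `a/2` (none below `0`),
stay otherwise — the birth-and-death chain `ladderWalk K a = bdKernel K (ladderUp K a) (ladderDown a)`.
Independence of successive swap decisions and uniformity of `a` along the ladder are the idealisation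
(the card's equal-acceptance tuning makes the second one the design; CARD-su3-ptbc §1.6).

## What is proved (`0 < a`; every hitting-time solution `h` of the walk, `h a b = E_a(τ_b)` in the
## convention of `RandomTargetLemma.IsHittingTimeSolution`)

* `ladderWalk_isRowStochastic` (`0 ≤ a ≤ 1`): it is a transition matrix.
* **`ladder_step_time`** — `E_i(τ_{i+1}) = 2(i+1)/a`: climbing one rung from position `i` costs
  `2(i+1)/a` rounds (the walk below `i` is a delay line).
* **`ladder_delivery_time`** — `E_0(τ_K) = K(K+1)/a`: THE DELIVERY TIME of a configuration (a new
  topological sector) from the open end to the physical end.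
* `sq_div_le_delivery`, `delivery_le_two_sq_div` — `K²/a ≤ K(K+1)/a ≤ 2K²/a` (`K ≥ 1`): the continuum
  proxy `(Λ/ℓ)²/erfc(ℓ/(2√2))` minimised in `Scaling/SwapSpacingOptimum` / `SwapAcceptanceOptimum`
  (`ladderCost`, `K = Λ/ℓ`, `a = erfc(ℓ/(2√2))`) IS the delivery time up to the factor `1 + 1/K`.

NOT CLAIMED: existence / uniqueness of the hitting-time solution is not re-derived here (it is the
tree's `exists_isHittingTimeSolution` / `IsHittingTimeSolution.unique` under irreducibility, which holds
for `a > 0` but is not typed for `bdKernel` in the tree — the statements below are about every solution,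
exactly as the Literature file states (2.13)–(2.14)); that PTBC label dynamics IS this walk (successive
swap decisions are correlated through the configurations; measured round-trip times are the card's
business); the return direction and round trips (by the reflection symmetry the same number; not typed).
-/

noncomputable section

open Finset
open Literature.Probability.MarkovChains

namespace Summit.Ventures.LatticeQCDFlow.Scaling

/-! ## The walk -/

/-- Up-rates of the label walk on `{0,…,K}`: `a/2` below the top, `0` at the top. [ours] -/
def ladderUp (K : ℕ) (a : ℝ) (k : ℕ) : ℝ := if k < K then a / 2 else 0

/-- Down-rates: `a/2` above `0`, `0` at `0`. [ours] -/
def ladderDown (a : ℝ) (k : ℕ) : ℝ := if k = 0 then 0 else a / 2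

/-- **The idealised label walk** of a `K`-interval ladder with uniform swap acceptance `a`
(a birth-and-death chain on `Fin (K+1)`). [ours] -/
def ladderWalk (K : ℕ) (a : ℝ) : Matrix (Fin (K + 1)) (Fin (K + 1)) ℝ :=
  bdKernel K (ladderUp K a) (ladderDown a)

/-- `ladderUp K a k = a/2` for `k < K`. [ours] -/
theorem ladderUp_of_lt {K : ℕ} (a : ℝ) {k : ℕ} (hk : k < K) : ladderUp K a k = a / 2 := if_pos hk

/-- `ladderUp K a K = 0`. [ours] -/
theorem ladderUp_top (K : ℕ) (a : ℝ) : ladderUp K a K = 0 := if_neg (lt_irrefl K)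

/-- `ladderDown a 0 = 0`. [ours] -/
theorem ladderDown_zero (a : ℝ) : ladderDown a 0 = 0 := if_pos rfl

/-- `ladderDown a k = a/2` for `1 ≤ k`. [ours] -/
theorem ladderDown_of_pos (a : ℝ) {k : ℕ} (hk : 1 ≤ k) : ladderDown a k = a / 2 := if_neg (by omega)

/-- **The label walk is a transition matrix** for `0 ≤ a ≤ 1`. [ours] -/
theorem ladderWalk_isRowStochastic (K : ℕ) {a : ℝ} (ha0 : 0 ≤ a) (ha1 : a ≤ 1) :
    IsRowStochastic (ladderWalk K a) := by
  refine bdKernel_isRowStochastic (fun k => ?_) (fun k => ?_) (fun k => ?_) (ladderDown_zero a)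
    (ladderUp_top K a)
  · unfold ladderUp; split_ifs <;> linarith
  · unfold ladderDown; split_ifs <;> linarith
  · unfold ladderUp ladderDown; split_ifs <;> linarith

/-! ## Passage times -/

section Passage

variable {K : ℕ} {a : ℝ} {h : Fin (K + 1) → Fin (K + 1) → ℝ}

/-- **One rung costs `2(i+1)/a` rounds**: `E_i(τ_{i+1}) = (i+1)/(a/2)` for the label walk
(Levin–Peres–Wilmer §2.5, constant rates `p = q = a/2`). [ours] -/
theorem ladder_step_time (hh : IsHittingTimeSolution (ladderWalk K a) h) (ha : 0 < a) (i : Fin K) :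
    h i.castSucc i.succ = 2 * ((i.val : ℝ) + 1) / a := by
  have h2 : a / 2 ≠ 0 := by positivity
  have key := LevinPeres2017_sec_2_5_const_eq (n := K) (p := ladderUp K a) (q := ladderDown a) hh h2
    (ladderDown_zero a) (fun k hk => ladderUp_of_lt a hk) (fun k hk _ => ladderDown_of_pos a hk) i
  rw [key]
  push_cast
  field_simp

/-- **THE DELIVERY TIME: `E_0(τ_K) = K(K+1)/a`.**  A configuration at the open end of a `K`-interval
ladder with uniform swap acceptance `a` reaches the physical end after `K(K+1)/a` rounds in expectation
(sum of the rung times `2(i+1)/a`). [ours] -/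
theorem ladder_delivery_time (hh : IsHittingTimeSolution (ladderWalk K a) h) (ha : 0 < a) :
    h 0 (Fin.last K) = (K : ℝ) * (K + 1) / a := by
  have h2 : a / 2 ≠ 0 := by positivity
  have hsum := LevinPeres2017_sec_2_5_sum (n := K) (p := ladderUp K a) (q := ladderDown a) hh
    (ladderDown_zero a) (fun k hk => by rw [ladderUp_of_lt a hk]; exact h2)
    (fun k hk _ => by rw [ladderDown_of_pos a hk]; exact h2) (Fin.zero_le (Fin.last K))
  rw [hsum]
  have hterm : ∀ i : Fin K, (if (0 : Fin (K + 1)).val ≤ i.val ∧ i.val < (Fin.last K).val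
      then h i.castSucc i.succ else 0) = 2 * ((i.val : ℝ) + 1) / a := by
    intro i
    rw [if_pos ⟨Nat.zero_le _, by rw [Fin.val_last]; exact i.isLt⟩, ladder_step_time hh ha i]
  rw [sum_congr rfl fun i _ => hterm i, Fin.sum_univ_eq_sum_range (fun m : ℕ => 2 * ((m : ℝ) + 1) / a) K]
  have : ∑ i ∈ range K, 2 * ((i : ℝ) + 1) / a = 2 / a * ∑ i ∈ range K, ((i : ℝ) + 1) := by
    rw [mul_sum]; exact sum_congr rfl fun i _ => by ring
  -- `Σ_{i<n} (i+1) = n(n+1)/2` (the tree's `…Balaban1983to89…sum_range_cast_add_one`; re-derived inline)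
  have hgauss : ∀ n : ℕ, ∑ i ∈ range n, ((i : ℝ) + 1) = (n : ℝ) * (n + 1) / 2 := by
    intro n
    induction n with
    | zero => simp
    | succ n ih => rw [sum_range_succ, ih]; push_cast; ring
  rw [this, hgauss K]
  field_simp

end Passage

/-! ## The continuum proxy `K²/a` is the delivery time up to the factor `1 + 1/K` -/

section Proxy

/-- `K²/a ≤ K(K+1)/a` (`a > 0`). [ours] -/
theorem sq_div_le_delivery (K : ℕ) {a : ℝ} (ha : 0 < a) :
    (K : ℝ) ^ 2 / a ≤ (K : ℝ) * (K + 1) / a := by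
  have hK : (0 : ℝ) ≤ K := Nat.cast_nonneg K
  exact div_le_div_of_nonneg_right (by nlinarith) ha.le

/-- `K(K+1)/a ≤ 2K²/a` for `K ≥ 1` (`a > 0`): the finite-ladder factor `1 + 1/K` is at most `2`.
[ours] -/
theorem delivery_le_two_sq_div {K : ℕ} (hK : 1 ≤ K) {a : ℝ} (ha : 0 < a) :
    (K : ℝ) * (K + 1) / a ≤ 2 * (K : ℝ) ^ 2 / a := by
  have hK' : (1 : ℝ) ≤ K := by exact_mod_cast hK
  exact div_le_div_of_nonneg_right (by nlinarith) ha.le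

/-- The delivery time written as the proxy times the finite-ladder factor:
`K(K+1)/a = (K²/a)·(1 + 1/K)` (`K ≥ 1`). [ours] -/
theorem delivery_eq_proxy_mul {K : ℕ} (hK : 1 ≤ K) (a : ℝ) :
    (K : ℝ) * (K + 1) / a = (K : ℝ) ^ 2 / a * (1 + 1 / K) := by
  have hK' : (K : ℝ) ≠ 0 := by exact_mod_cast (show K ≠ 0 by omega)
  field_simp

end Proxy


/-! ## (Appended, GEN-4) The walk is irreducible for `a > 0`, so its hitting times exist and are unique:
the delivery-time statement is not vacuous -/

section Irreducible

variable {n : ℕ} {p q : ℕ → ℝ}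

/-- Powers of a row-stochastic matrix have nonnegative entries. [folklore] -/
theorem pow_apply_nonneg_of_isRowStochastic {X : Type*} [Fintype X] [DecidableEq X]
    {P : Matrix X X ℝ} (hP : IsRowStochastic P) :
    ∀ (d : ℕ) (x y : X), 0 ≤ (P ^ d) x y
  | 0, x, y => by rw [pow_zero, Matrix.one_apply]; split_ifs <;> norm_num
  | d + 1, x, y => by
    rw [pow_succ, Matrix.mul_apply]
    exact sum_nonneg fun z _ => mul_nonneg (pow_apply_nonneg_of_isRowStochastic hP d x z) (hP.1 z y)

/-- **Upward reachability in a birth-and-death chain**: with positive up-rates below the top,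
`(P^d)(i, i+d) > 0`. [folklore] -/
theorem bdKernel_pow_apply_pos_up (hP : IsRowStochastic (bdKernel n p q))
    (hp : ∀ k, k < n → 0 < p k) :
    ∀ (d : ℕ) (i j : Fin (n + 1)), j.val = i.val + d → 0 < (bdKernel n p q ^ d) i j
  | 0, i, j, h => by
    have hij : i = j := Fin.ext (by omega)
    subst hij
    rw [pow_zero, Matrix.one_apply_eq]; norm_num
  | d + 1, i, j, h => by
    have hm : i.val + d < n + 1 := by have := j.isLt; omega
    have ih := bdKernel_pow_apply_pos_up hP hp d i ⟨i.val + d, hm⟩ rfl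
    rw [pow_succ, Matrix.mul_apply]
    have hstep : 0 < bdKernel n p q ⟨i.val + d, hm⟩ j := by
      rw [bdKernel_apply_succ (by simp only; omega)]
      exact hp _ (by have := j.isLt; simp only; omega)
    calc 0 < (bdKernel n p q ^ d) i ⟨i.val + d, hm⟩ * bdKernel n p q ⟨i.val + d, hm⟩ j := mul_pos ih hstep
      _ ≤ ∑ k, (bdKernel n p q ^ d) i k * bdKernel n p q k j :=
          single_le_sum (f := fun k => (bdKernel n p q ^ d) i k * bdKernel n p q k j)
            (fun k _ => mul_nonneg (pow_apply_nonneg_of_isRowStochastic hP d i k) (hP.1 k j)) (mem_univ _)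

/-- **Downward reachability**: with positive down-rates above `0`, `(P^d)(i, i−d) > 0`. [folklore] -/
theorem bdKernel_pow_apply_pos_down (hP : IsRowStochastic (bdKernel n p q))
    (hq : ∀ k, 1 ≤ k → k ≤ n → 0 < q k) :
    ∀ (d : ℕ) (i j : Fin (n + 1)), i.val = j.val + d → 0 < (bdKernel n p q ^ d) i j
  | 0, i, j, h => by
    have hij : i = j := Fin.ext (by omega)
    subst hij
    rw [pow_zero, Matrix.one_apply_eq]; norm_num
  | d + 1, i, j, h => by
    have hm : j.val + 1 < n + 1 := by have := i.isLt; omega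
    have ih := bdKernel_pow_apply_pos_down hP hq d i ⟨j.val + 1, hm⟩ (by simp only; omega)
    rw [pow_succ, Matrix.mul_apply]
    have hstep : 0 < bdKernel n p q ⟨j.val + 1, hm⟩ j := by
      rw [bdKernel_apply_pred (by simp only)]
      exact hq _ (by simp only; omega) (by have := i.isLt; simp only; omega)
    calc 0 < (bdKernel n p q ^ d) i ⟨j.val + 1, hm⟩ * bdKernel n p q ⟨j.val + 1, hm⟩ j := mul_pos ih hstep
      _ ≤ ∑ k, (bdKernel n p q ^ d) i k * bdKernel n p q k j :=
          single_le_sum (f := fun k => (bdKernel n p q ^ d) i k * bdKernel n p q k j)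
            (fun k _ => mul_nonneg (pow_apply_nonneg_of_isRowStochastic hP d i k) (hP.1 k j)) (mem_univ _)

/-- **A birth-and-death chain with positive rates (`p_k > 0` below the top, `q_k > 0` above `0`) is
irreducible.** [folklore] -/
theorem bdKernel_isIrreducible (hP : IsRowStochastic (bdKernel n p q)) (hp : ∀ k, k < n → 0 < p k)
    (hq : ∀ k, 1 ≤ k → k ≤ n → 0 < q k) : IsIrreducible (bdKernel n p q) := by
  intro x y
  rcases le_or_gt x.val y.val with hxy | hxy
  · exact ⟨y.val - x.val, bdKernel_pow_apply_pos_up hP hp _ x y (by omega)⟩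
  · exact ⟨x.val - y.val, bdKernel_pow_apply_pos_down hP hq _ x y (by omega)⟩

/-- **The label walk is irreducible** for `0 < a ≤ 1`. [ours] -/
theorem ladderWalk_isIrreducible (K : ℕ) {a : ℝ} (ha0 : 0 < a) (ha1 : a ≤ 1) :
    IsIrreducible (ladderWalk K a) :=
  bdKernel_isIrreducible (ladderWalk_isRowStochastic K ha0.le ha1)
    (fun k hk => by rw [ladderUp_of_lt a hk]; positivity)
    (fun k hk _ => by rw [ladderDown_of_pos a hk]; positivity)

/-- **Hitting times of the label walk exist and are unique** (`0 < a ≤ 1`): the tree's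
`exists_isHittingTimeSolution` / `IsHittingTimeSolution.unique` for irreducible chains. [ours] -/
theorem existsUnique_ladder_hittingTime (K : ℕ) {a : ℝ} (ha0 : 0 < a) (ha1 : a ≤ 1) :
    ∃! h : Fin (K + 1) → Fin (K + 1) → ℝ, IsHittingTimeSolution (ladderWalk K a) h := by
  have hP := ladderWalk_isRowStochastic K ha0.le ha1
  have hirr := ladderWalk_isIrreducible K ha0 ha1
  obtain ⟨h, hh⟩ := exists_isHittingTimeSolution hP hirr
  exact ⟨h, hh, fun h' hh' => IsHittingTimeSolution.unique hP hirr hh' hh⟩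

/-- **THE DELIVERY TIME, non-vacuous form** (`0 < a ≤ 1`): THE hitting-time function of the label walk
exists, and its value from the open end to the physical end is `K(K+1)/a`. [ours] -/
theorem ladder_delivery_time' (K : ℕ) {a : ℝ} (ha0 : 0 < a) (ha1 : a ≤ 1) :
    ∃ h : Fin (K + 1) → Fin (K + 1) → ℝ, IsHittingTimeSolution (ladderWalk K a) h ∧
      h 0 (Fin.last K) = (K : ℝ) * (K + 1) / a := by
  obtain ⟨h, hh, -⟩ := existsUnique_ladder_hittingTime K ha0 ha1
  exact ⟨h, hh, ladder_delivery_time hh ha0⟩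

end Irreducible


/-! ## (Appended, GEN-4) Reflection symmetry of the uniform ladder: the return trip costs the same, so the
round trip (commute time) is `2K(K+1)/a` -/

section RoundTrip

/-- **A kernel automorphism transports hitting-time solutions**: if `P (σ a) (σ b) = P a b` for a
bijection `σ`, then `(a, b) ↦ h (σ a) (σ b)` solves the first-step equations whenever `h` does. [folklore] -/
theorem isHittingTimeSolution_comp_equiv {X : Type*} [Fintype X] [DecidableEq X] {P : Matrix X X ℝ}
    {h : X → X → ℝ} (hh : IsHittingTimeSolution P h) (σ : X ≃ X) (hσ : ∀ a b, P (σ a) (σ b) = P a b) :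
    IsHittingTimeSolution P fun a b => h (σ a) (σ b) := by
  refine ⟨fun x => hh.1 (σ x), fun a x hax => ?_⟩
  have hne : σ a ≠ σ x := fun e => hax (σ.injective e)
  show h (σ a) (σ x) = 1 + ∑ y, P a y * h (σ y) (σ x)
  rw [hh.2 (σ a) (σ x) hne, ← Equiv.sum_comp σ (fun y => P (σ a) y * h y (σ x))]
  simp only [hσ]

/-- **The uniform ladder walk is symmetric under the reflection `i ↦ K − i`** (`Fin.rev`): up-rate
`a/2` below the top ↔ down-rate `a/2` above the bottom. [ours] -/
theorem ladderWalk_rev (K : ℕ) (a : ℝ) (i j : Fin (K + 1)) :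
    ladderWalk K a (Fin.rev i) (Fin.rev j) = ladderWalk K a i j := by
  unfold ladderWalk
  have hi := i.isLt
  have hj := j.isLt
  have hvi : (Fin.rev i).val = K - i.val := by rw [Fin.val_rev]; omega
  have hvj : (Fin.rev j).val = K - j.val := by rw [Fin.val_rev]; omega
  by_cases hup : j.val = i.val + 1
  · rw [bdKernel_apply_succ hup, bdKernel_apply_pred (show (Fin.rev i).val = (Fin.rev j).val + 1 by omega),
      hvi, ladderUp_of_lt a (show i.val < K by omega), ladderDown_of_pos a (show 1 ≤ K - i.val by omega)]
  by_cases hdown : i.val = j.val + 1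
  · rw [bdKernel_apply_pred hdown, bdKernel_apply_succ (show (Fin.rev j).val = (Fin.rev i).val + 1 by omega),
      hvi, ladderDown_of_pos a (show 1 ≤ i.val by omega), ladderUp_of_lt a (show K - i.val < K by omega)]
  by_cases heq : i = j
  · subst heq
    rw [bdKernel_apply_self, bdKernel_apply_self, hvi]
    unfold ladderUp ladderDown
    split_ifs <;> first | rfl | (exfalso; omega) | ring
  · have hrne : Fin.rev i ≠ Fin.rev j := fun e => heq (Fin.rev_inj.1 e)
    rw [bdKernel_apply_of_ne hup hdown heq,
      bdKernel_apply_of_ne (show (Fin.rev j).val ≠ (Fin.rev i).val + 1 by omega)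
        (show (Fin.rev i).val ≠ (Fin.rev j).val + 1 by omega) hrne]

/-- **The return trip costs the same**: `E_K(τ_0) = E_0(τ_K) = K(K+1)/a` for the (unique) hitting times of
the uniform ladder walk (`0 < a ≤ 1`). [ours] -/
theorem ladder_return_time {K : ℕ} {a : ℝ} (ha0 : 0 < a) (ha1 : a ≤ 1)
    {h : Fin (K + 1) → Fin (K + 1) → ℝ} (hh : IsHittingTimeSolution (ladderWalk K a) h) :
    h (Fin.last K) 0 = (K : ℝ) * (K + 1) / a := by
  have hP := ladderWalk_isRowStochastic K ha0.le ha1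
  have hirr := ladderWalk_isIrreducible K ha0 ha1
  -- the reflected solution is a solution, hence equal to `h`
  have hh' : IsHittingTimeSolution (ladderWalk K a) fun x y => h (Fin.rev x) (Fin.rev y) :=
    isHittingTimeSolution_comp_equiv hh Fin.revPerm (fun x y => ladderWalk_rev K a x y)
  have heq := IsHittingTimeSolution.unique hP hirr hh' hh
  have key := congrFun (congrFun heq 0) (Fin.last K)
  simp only [Fin.rev_zero, Fin.rev_last] at key
  rw [key]
  exact ladder_delivery_time hh ha0

/-- **THE ROUND TRIP (commute time) of the label walk is `2K(K+1)/a`** (`0 < a ≤ 1`). [ours] -/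
theorem ladder_round_trip {K : ℕ} {a : ℝ} (ha0 : 0 < a) (ha1 : a ≤ 1)
    {h : Fin (K + 1) → Fin (K + 1) → ℝ} (hh : IsHittingTimeSolution (ladderWalk K a) h) :
    h 0 (Fin.last K) + h (Fin.last K) 0 = 2 * ((K : ℝ) * (K + 1) / a) := by
  rw [ladder_delivery_time hh ha0, ladder_return_time ha0 ha1 hh]
  ring

end RoundTrip

/-! ## (Appended, GEN-6) Passage from an interior rung: `E_i(τ_K) = (K(K+1) − i(i+1))/a` and, by the
reflection, `E_i(τ_0) = (K(K+1) − (K−i)(K−i+1))/a` — the delivery of a configuration now at rung `i` -/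

section PassageFrom

variable {K : ℕ} {a : ℝ} {h : Fin (K + 1) → Fin (K + 1) → ℝ}

/-- **DELIVERY FROM RUNG `i`: `E_i(τ_K) = (K(K+1) − i(i+1))/a`** — the rung times `2(k+1)/a` summed over
`i ≤ k < K` ("to find `E_a(τ_b)`, just sum"); `i = 0` is `ladder_delivery_time`.  The remaining fraction of the
full delivery time from rung `i` is `1 − i(i+1)/(K(K+1))`: from the middle of the ladder still about `3/4` —
the top rungs dominate the passage to the physical end. [ours] -/
theorem ladder_delivery_time_from (hh : IsHittingTimeSolution (ladderWalk K a) h) (ha : 0 < a)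
    (i : Fin (K + 1)) :
    h i (Fin.last K) = ((K : ℝ) * (K + 1) - (i.val : ℝ) * (i.val + 1)) / a := by
  have h2 : a / 2 ≠ 0 := by positivity
  have hsum := LevinPeres2017_sec_2_5_sum (n := K) (p := ladderUp K a) (q := ladderDown a) hh
    (ladderDown_zero a) (fun k hk => by rw [ladderUp_of_lt a hk]; exact h2)
    (fun k hk _ => by rw [ladderDown_of_pos a hk]; exact h2) (Fin.le_last i)
  rw [hsum]
  have hterm : ∀ k : Fin K, (if i.val ≤ k.val ∧ k.val < (Fin.last K).val
      then h k.castSucc k.succ else 0) = if i.val ≤ k.val then 2 * ((k.val : ℝ) + 1) / a else 0 := by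
    intro k
    by_cases hk : i.val ≤ k.val
    · rw [if_pos ⟨hk, by rw [Fin.val_last]; exact k.isLt⟩, if_pos hk, ladder_step_time hh ha k]
    · rw [if_neg (fun hc => hk hc.1), if_neg hk]
  rw [sum_congr rfl fun k _ => hterm k,
    Fin.sum_univ_eq_sum_range (fun m : ℕ => if i.val ≤ m then 2 * ((m : ℝ) + 1) / a else 0) K]
  have hiK : i.val ≤ K := Nat.lt_succ_iff.mp i.isLt
  have hsplit : ∑ m ∈ range K, (if i.val ≤ m then 2 * ((m : ℝ) + 1) / a else 0)
      = ∑ m ∈ Ico i.val K, 2 * ((m : ℝ) + 1) / a := by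
    rw [← sum_filter]
    congr 1
    ext m
    simp only [mem_filter, mem_range, mem_Ico]
    omega
  rw [hsplit, sum_Ico_eq_sub _ hiK]
  -- `Σ_{m<n} (m+1) = n(n+1)/2` (the tree's `…Balaban1983to89…sum_range_cast_add_one`; re-derived inline)
  have hgauss : ∀ n : ℕ, ∑ m ∈ range n, ((m : ℝ) + 1) = (n : ℝ) * (n + 1) / 2 := by
    intro n
    induction n with
    | zero => simp
    | succ n ih => rw [sum_range_succ, ih]; push_cast; ring
  have hlin : ∀ n : ℕ, ∑ m ∈ range n, 2 * ((m : ℝ) + 1) / a = 2 / a * ((n : ℝ) * (n + 1) / 2) := by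
    intro n
    rw [← hgauss n, mul_sum]
    exact sum_congr rfl fun m _ => by ring
  rw [hlin K, hlin i.val]
  field_simp

/-- **PASSAGE TO THE OPEN END FROM RUNG `i`: `E_i(τ_0) = (K(K+1) − (K−i)(K−i+1))/a`** (`0 < a ≤ 1`; the
reflection `i ↦ K − i` of `ladderWalk_rev` transports `ladder_delivery_time_from`); `i = K` is
`ladder_return_time`. [ours] -/
theorem ladder_return_time_from (ha0 : 0 < a) (ha1 : a ≤ 1) (hh : IsHittingTimeSolution (ladderWalk K a) h)
    (i : Fin (K + 1)) :
    h i 0 = ((K : ℝ) * (K + 1) - ((K - i.val : ℕ) : ℝ) * ((K - i.val : ℕ) + 1)) / a := by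
  have hP := ladderWalk_isRowStochastic K ha0.le ha1
  have hirr := ladderWalk_isIrreducible K ha0 ha1
  have hh' : IsHittingTimeSolution (ladderWalk K a) fun x y => h (Fin.rev x) (Fin.rev y) :=
    isHittingTimeSolution_comp_equiv hh Fin.revPerm (fun x y => ladderWalk_rev K a x y)
  have heq := IsHittingTimeSolution.unique hP hirr hh' hh
  have key := congrFun (congrFun heq (Fin.rev i)) (Fin.last K)
  simp only [Fin.rev_rev, Fin.rev_last] at key
  rw [key, ladder_delivery_time_from hh ha0 (Fin.rev i)]
  have hv : (Fin.rev i).val = K - i.val := by rw [Fin.val_rev]; omega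
  rw [hv]

end PassageFrom

end Summit.Ventures.LatticeQCDFlow.Scaling

end
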